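import Literature.Probability.Percolation.PlanarDuality
import HarnessLib

/-!
# The cycle space of the square lattice is generated by the unit squares

Topic `Probability/Percolation`. Mod-2 edge sets of `ℤ²` and the first input of Timár's
graph-theoretic approach to boundary connectivity (Á. Timár, *Boundary-connectivity via graph
theory*, Proc. AMS 141 (2013), §2: "the cycle space of `ℤ^d` is generated by the 4-cycles"), which
we use in `BoundaryConnectivity.lean` for the `∗`-connectedness of outer boundaries of clusters in
`ℤ²` (Kesten 1982, §2.2; Georgii–Higuchi 2000, proof of Lemma 2.3):

* `OddDeg E v`, `IsEulerian E` — parity of the degree of a vertex in a finite edge set, even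
  edge sets; behaviour under symmetric difference (`oddDeg_symmDiff_iff`);
* `xorSum f s` — the mod-2 sum of a finite family of edge sets (`mem_xorSum_iff`, `xorSum_insert`,
  `xorSum_symmDiff`, `isEulerian_xorSum`);
* `Walk.edgeParity` — the mod-2 edge set of a walk; its odd vertices are exactly the two ends
  (`oddDeg_edgeParity_iff`);
* `unitSq u` — the four edges of the unit square with lower-left corner `u`;
  **`exists_eq_xorSum_unitSq`** — every finite even set of lattice edges of `ℤ²` is a mod-2 sum of
  unit squares (induction on the lexicographically largest vertex: its two edges are the top and
  right sides of a unit square, which is subtracted).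

## References

* Á. Timár, Proc. Amer. Math. Soc. 141 (2013) 475–480, §2 [Timar2013].
* H. Kesten, *Percolation theory for mathematicians*, Birkhäuser 1982, §2.2 [Kesten1982].
-/

noncomputable section

open SimpleGraph Finset
open scoped symmDiff
open Literature.Probability.LatticeModels (Site zdGraph zdGraph_adj_iff)

namespace Literature.Probability.Percolation

/-! ### Parity of degrees, even edge sets, mod-2 sums -/

section Parity

variable {V : Type*} [DecidableEq V]

/-- `v` has odd degree in the finite edge set `E`. [cite: Timar2013, §2] -/
def OddDeg (E : Finset (Sym2 V)) (v : V) : Prop := Odd #(E.filter fun e => v ∈ e)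

/-- An **even** (Eulerian, cycle-space) edge set: all degrees are even. [cite: Timar2013, §2] -/
def IsEulerian (E : Finset (Sym2 V)) : Prop := ∀ v, ¬ OddDeg E v

omit [DecidableEq V] in
/-- Parity of the size of a symmetric difference. [folklore] -/
theorem odd_card_symmDiff_iff {α : Type*} [DecidableEq α] (A B : Finset α) :
    Odd #(A ∆ B) ↔ (Odd #A ↔ ¬ Odd #B) := by
  have hA := Finset.card_sdiff_add_card_inter A B
  have hB := Finset.card_sdiff_add_card_inter B A
  have hAB : #(A ∆ B) = #(A \ B) + #(B \ A) := by
    rw [Finset.symmDiff_def, Finset.card_union_of_disjoint disjoint_sdiff_sdiff]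
  rw [Finset.inter_comm] at hB
  have h1 : #(A ∆ B) + 2 * #(A ∩ B) = #A + #B := by omega
  have h2 : Odd #(A ∆ B) ↔ Odd (#A + #B) := by
    rw [← h1, Nat.odd_add]
    simp
  rw [h2, Nat.odd_add, ← Nat.not_odd_iff_even]

/-- Odd degree in a symmetric difference is the exclusive or. [cite: Timar2013, §2] -/
theorem oddDeg_symmDiff_iff (E F : Finset (Sym2 V)) (v : V) :
    OddDeg (E ∆ F) v ↔ (OddDeg E v ↔ ¬ OddDeg F v) := by
  unfold OddDeg
  rw [show (E ∆ F).filter (fun e => v ∈ e) = E.filter (fun e => v ∈ e) ∆ F.filter (fun e => v ∈ e) by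
    ext e; simp only [Finset.mem_filter, Finset.mem_symmDiff]; tauto]
  exact odd_card_symmDiff_iff _ _

/-- No vertex is odd in the empty edge set. [folklore] -/
theorem not_oddDeg_empty (v : V) : ¬ OddDeg (∅ : Finset (Sym2 V)) v := by
  simp [OddDeg]

/-- The odd vertices of a single edge are its two endpoints. [folklore] -/
theorem oddDeg_singleton_iff (a b : V) (v : V) :
    OddDeg ({s(a, b)} : Finset (Sym2 V)) v ↔ v = a ∨ v = b := by
  unfold OddDeg
  by_cases h : v = a ∨ v = b
  · have : ({s(a, b)} : Finset (Sym2 V)).filter (fun e => v ∈ e) = {s(a, b)} := by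
      ext e; simp only [Finset.mem_filter, Finset.mem_singleton]
      constructor
      · exact fun h' => h'.1
      · intro h'; subst h'; exact ⟨rfl, Sym2.mem_iff.2 h⟩
    rw [this]; simp [h]
  · have : ({s(a, b)} : Finset (Sym2 V)).filter (fun e => v ∈ e) = ∅ := by
      ext e; simp only [Finset.mem_filter, Finset.mem_singleton, Finset.notMem_empty, iff_false, not_and]
      intro h'; subst h'; exact fun h'' => h (Sym2.mem_iff.1 h'')
    rw [this]; simp [h]

/-- Symmetric differences of even sets are even. [cite: Timar2013, §2] -/
theorem IsEulerian.symmDiff {E F : Finset (Sym2 V)} (hE : IsEulerian E) (hF : IsEulerian F) :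
    IsEulerian (E ∆ F) := fun v h => by
  rw [oddDeg_symmDiff_iff] at h
  exact hE v (h.2 (hF v))

variable {ι : Type*}

/-- The **mod-2 sum** of the edge sets `f i`, `i ∈ s`. [cite: Timar2013, §2] -/
def xorSum (f : ι → Finset (Sym2 V)) (s : Finset ι) : Finset (Sym2 V) :=
  (s.biUnion f).filter fun e => Odd #(s.filter fun i => e ∈ f i)

/-- Membership in the mod-2 sum: `e` lies in an odd number of the sets. [cite: Timar2013, §2] -/
theorem mem_xorSum_iff {f : ι → Finset (Sym2 V)} {s : Finset ι} {e : Sym2 V} :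
    e ∈ xorSum f s ↔ Odd #(s.filter fun i => e ∈ f i) := by
  rw [xorSum, Finset.mem_filter]
  constructor
  · exact fun h => h.2
  · intro h
    refine ⟨?_, h⟩
    obtain ⟨i, hi⟩ : (s.filter fun i => e ∈ f i).Nonempty := by
      rw [Finset.nonempty_iff_ne_empty]; intro h0; rw [h0] at h; simp at h
    exact Finset.mem_biUnion.2 ⟨i, (Finset.mem_filter.1 hi).1, (Finset.mem_filter.1 hi).2⟩

/-- A member of the mod-2 sum lies in one of the sets. [folklore] -/
theorem exists_mem_of_mem_xorSum {f : ι → Finset (Sym2 V)} {s : Finset ι} {e : Sym2 V}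
    (h : e ∈ xorSum f s) : ∃ i ∈ s, e ∈ f i := by
  rw [xorSum, Finset.mem_filter, Finset.mem_biUnion] at h
  exact h.1

/-- The empty sum. [folklore] -/
theorem xorSum_empty (f : ι → Finset (Sym2 V)) : xorSum f ∅ = ∅ := by
  ext e; simp [mem_xorSum_iff]

/-- Adding one set to a mod-2 sum. [cite: Timar2013, §2] -/
theorem xorSum_insert [DecidableEq ι] (f : ι → Finset (Sym2 V)) {s : Finset ι} {i : ι} (hi : i ∉ s) :
    xorSum f (insert i s) = f i ∆ xorSum f s := by
  ext e
  rw [mem_xorSum_iff, Finset.mem_symmDiff, mem_xorSum_iff, Finset.filter_insert]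
  by_cases he : e ∈ f i
  · rw [if_pos he, Finset.card_insert_of_notMem (fun h => hi (Finset.mem_filter.1 h).1), Nat.odd_add_one]
    tauto
  · rw [if_neg he]
    tauto

/-- Mod-2 sums of even sets are even. [cite: Timar2013, §2] -/
theorem isEulerian_xorSum [DecidableEq ι] {f : ι → Finset (Sym2 V)} {s : Finset ι} (h : ∀ i ∈ s, IsEulerian (f i)) :
    IsEulerian (xorSum f s) := by
  induction s using Finset.induction_on with
  | empty => rw [xorSum_empty]; exact fun v => not_oddDeg_empty v
  | insert i s hi ih =>
    rw [xorSum_insert f hi]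
    exact (h i (Finset.mem_insert_self i s)).symmDiff (ih fun j hj => h j (Finset.mem_insert_of_mem hj))

/-- **Additivity**: `xorSum s ∆ xorSum t = xorSum (s ∆ t)`. [cite: Timar2013, §2] -/
theorem xorSum_symmDiff [DecidableEq ι] (f : ι → Finset (Sym2 V)) (s t : Finset ι) :
    xorSum f s ∆ xorSum f t = xorSum f (s ∆ t) := by
  ext e
  rw [Finset.mem_symmDiff, mem_xorSum_iff, mem_xorSum_iff, mem_xorSum_iff,
    show (s ∆ t).filter (fun i => e ∈ f i) = s.filter (fun i => e ∈ f i) ∆ t.filter (fun i => e ∈ f i) by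
      ext i; simp only [Finset.mem_filter, Finset.mem_symmDiff]; tauto,
    odd_card_symmDiff_iff]
  tauto

/-! ### The mod-2 edge set of a walk -/

/-- The mod-2 edge set of a walk: the edges traversed an odd number of times. [cite: Timar2013, §2] -/
def _root_.SimpleGraph.Walk.edgeParity {G : SimpleGraph V} : ∀ {a b : V}, G.Walk a b → Finset (Sym2 V)
  | _, _, Walk.nil => ∅
  | a, _, Walk.cons (v := c) _ p => {s(a, c)} ∆ p.edgeParity

/-- Edges of the mod-2 edge set are edges of the walk. [folklore] -/
theorem mem_edges_of_mem_edgeParity {G : SimpleGraph V} :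
    ∀ {a b : V} (p : G.Walk a b) {e : Sym2 V}, e ∈ p.edgeParity → e ∈ p.edges
  | _, _, Walk.nil, e, he => by simp [Walk.edgeParity] at he
  | a, _, Walk.cons (v := c) h p, e, he => by
    rw [Walk.edgeParity, Finset.mem_symmDiff, Finset.mem_singleton] at he
    rw [Walk.edges_cons, List.mem_cons]
    rcases he with ⟨rfl, -⟩ | ⟨he, -⟩
    · exact Or.inl rfl
    · exact Or.inr (mem_edges_of_mem_edgeParity p he)

/-- **The odd vertices of a walk are its two ends** (none if the walk is closed). [cite: Timar2013, §2] -/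
theorem oddDeg_edgeParity_iff {G : SimpleGraph V} :
    ∀ {a b : V} (p : G.Walk a b) (v : V), OddDeg p.edgeParity v ↔ (a ≠ b ∧ (v = a ∨ v = b))
  | _, _, Walk.nil, v => by simp [Walk.edgeParity, not_oddDeg_empty]
  | a, b, Walk.cons (v := c) h p, v => by
    rw [Walk.edgeParity, oddDeg_symmDiff_iff, oddDeg_singleton_iff, oddDeg_edgeParity_iff p v]
    have hac : a ≠ c := h.ne
    by_cases hva : v = a <;> by_cases hvb : v = b <;> by_cases hvc : v = c <;> subst_vars <;>
      simp_all [eq_comm]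

end Parity

/-! ### Unit squares generate the even edge sets of `ℤ²` -/

section Squares

/-- The unit vector `e₀`. [folklore] -/
abbrev ex : Site 2 := Pi.single 0 1
/-- The unit vector `e₁`. [folklore] -/
abbrev ey : Site 2 := Pi.single 1 1

/-- The closed walk around the unit square with lower-left corner `u`. [folklore] -/
def sqWalk (u : Site 2) : (zdGraph 2).Walk u u :=
  Walk.cons (v := u + ex) ((zdGraph_adj_iff _ _).2 ⟨0, Or.inl rfl⟩)
    (Walk.cons (v := u + ex + ey) ((zdGraph_adj_iff _ _).2 ⟨1, Or.inl rfl⟩)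
      (Walk.cons (v := u + ey) ((zdGraph_adj_iff _ _).2 ⟨0, Or.inr (by rw [add_right_comm])⟩)
        (Walk.cons (v := u) ((zdGraph_adj_iff _ _).2 ⟨1, Or.inr rfl⟩) Walk.nil)))

/-- The four edges of the **unit square** with lower-left corner `u` (as the mod-2 edge set of the
walk around it). [cite: Timar2013, §2] -/
def unitSq (u : Site 2) : Finset (Sym2 (Site 2)) := (sqWalk u).edgeParity

/-- The unit square is an even edge set. [cite: Timar2013, §2] -/
theorem isEulerian_unitSq (u : Site 2) : IsEulerian (unitSq u) := fun v h => by
  rw [unitSq, oddDeg_edgeParity_iff] at h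
  exact h.1 rfl

/-- The edges of a unit square are lattice edges. [folklore] -/
theorem unitSq_subset_edgeSet (u : Site 2) : ∀ e ∈ unitSq u, e ∈ (zdGraph 2).edgeSet := fun _ he =>
  Walk.edges_subset_edgeSet _ (mem_edges_of_mem_edgeParity _ he)

/-- The edges of the unit square, as a list of four. [folklore] -/
theorem mem_unitSq {u : Site 2} {e : Sym2 (Site 2)} (he : e ∈ unitSq u) :
    e = s(u, u + ex) ∨ e = s(u + ex, u + ex + ey) ∨ e = s(u + ex + ey, u + ey) ∨ e = s(u + ey, u) := by
  have h := mem_edges_of_mem_edgeParity _ he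
  simpa [sqWalk, Walk.edges_cons] using h

/-- Every vertex of an edge of `unitSq u` is a corner `u + (a, b)`, `a, b ∈ {0, 1}`. [folklore] -/
theorem corner_of_mem_unitSq {u v : Site 2} {e : Sym2 (Site 2)} (he : e ∈ unitSq u) (hv : v ∈ e) :
    ∀ i, u i ≤ v i ∧ v i ≤ u i + 1 := by
  intro i
  rcases mem_unitSq he with rfl | rfl | rfl | rfl <;> rw [Sym2.mem_iff] at hv <;> rcases hv with rfl | rfl <;>
    fin_cases i <;> simp

/-- Distinctness of the corners of a unit square. [folklore] -/
theorem unitSq_corners_ne (u : Site 2) :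
    u ≠ u + ex ∧ u ≠ u + ey ∧ u ≠ u + ex + ey ∧ u + ex ≠ u + ey ∧ u + ex ≠ u + ex + ey ∧ u + ey ≠ u + ex + ey := by
  refine ⟨?_, ?_, ?_, ?_, ?_, ?_⟩ <;> intro h
  · have := congr_fun h 0; simp at this
  · have := congr_fun h 1; simp at this
  · have := congr_fun h 0; simp at this
  · have := congr_fun h 0; simp at this
  · have := congr_fun h 1; simp at this
  · have := congr_fun h 0; simp at this

/-- The four edges of a unit square are pairwise distinct. [folklore] -/
theorem unitSq_edges_ne (u : Site 2) :
    s(u, u + ex) ≠ s(u + ex, u + ex + ey) ∧ s(u, u + ex) ≠ s(u + ex + ey, u + ey) ∧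
      s(u, u + ex) ≠ s(u + ey, u) ∧ s(u + ex, u + ex + ey) ≠ s(u + ex + ey, u + ey) ∧
      s(u + ex, u + ex + ey) ≠ s(u + ey, u) ∧ s(u + ex + ey, u + ey) ≠ s(u + ey, u) := by
  obtain ⟨h1, h2, h3, h4, h5, h6⟩ := unitSq_corners_ne u
  simp [h1, h2, h3, h4, h5, h1.symm, h2.symm, h3.symm, h6.symm]

/-- Membership of a different element in `{b} ∆ S`. [folklore] -/
theorem mem_singleton_symmDiff_of_ne {α : Type*} [DecidableEq α] {a b : α} {S : Finset α} (h : a ≠ b) :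
    a ∈ ({b} : Finset α) ∆ S ↔ a ∈ S := by
  rw [Finset.mem_symmDiff, Finset.mem_singleton]; tauto

/-- `a ∈ {a} ∆ S` when `a ∉ S`. [folklore] -/
theorem self_mem_singleton_symmDiff {α : Type*} [DecidableEq α] {a : α} {S : Finset α} (h : a ∉ S) :
    a ∈ ({a} : Finset α) ∆ S :=
  Finset.mem_symmDiff.2 (Or.inl ⟨Finset.mem_singleton_self a, h⟩)

/-- The right side belongs to the unit square. [folklore] -/
theorem right_mem_unitSq (u : Site 2) : s(u + ex, u + ex + ey) ∈ unitSq u := by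
  obtain ⟨d1, -, -, d4, d5, -⟩ := unitSq_edges_ne u
  change s(u + ex, u + ex + ey) ∈ ({s(u, u + ex)} : Finset _) ∆ (({s(u + ex, u + ex + ey)} : Finset _) ∆
    (({s(u + ex + ey, u + ey)} : Finset _) ∆ (({s(u + ey, u)} : Finset _) ∆ ∅)))
  rw [mem_singleton_symmDiff_of_ne (Ne.symm d1)]
  refine self_mem_singleton_symmDiff fun h => ?_
  rw [mem_singleton_symmDiff_of_ne d4, mem_singleton_symmDiff_of_ne d5] at h
  simp at h

/-- The top side belongs to the unit square. [folklore] -/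
theorem top_mem_unitSq (u : Site 2) : s(u + ey, u + ex + ey) ∈ unitSq u := by
  obtain ⟨-, d2, -, d4, -, d6⟩ := unitSq_edges_ne u
  rw [show s(u + ey, u + ex + ey) = s(u + ex + ey, u + ey) from Sym2.eq_swap]
  change s(u + ex + ey, u + ey) ∈ ({s(u, u + ex)} : Finset _) ∆ (({s(u + ex, u + ex + ey)} : Finset _) ∆
    (({s(u + ex + ey, u + ey)} : Finset _) ∆ (({s(u + ey, u)} : Finset _) ∆ ∅)))
  rw [mem_singleton_symmDiff_of_ne (Ne.symm d2), mem_singleton_symmDiff_of_ne (Ne.symm d4)]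
  refine self_mem_singleton_symmDiff fun h => ?_
  rw [mem_singleton_symmDiff_of_ne d6] at h
  simp at h

/-- The vertices of a finite edge set. [folklore] -/
def verts (E : Finset (Sym2 (Site 2))) : Finset (Site 2) := E.biUnion Sym2.toFinset

/-- Membership in the vertex set. [folklore] -/
theorem mem_verts {E : Finset (Sym2 (Site 2))} {v : Site 2} : v ∈ verts E ↔ ∃ e ∈ E, v ∈ e := by
  simp [verts, Sym2.mem_toFinset]

/-- **In an even set of lattice edges, the lexicographically largest vertex is the top-right corner
of a unit square whose top and right sides are the two edges at that vertex.** [cite: Timar2013, §2] -/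
theorem edges_at_max_vertex {E : Finset (Sym2 (Site 2))} (hE : ∀ e ∈ E, e ∈ (zdGraph 2).edgeSet)
    (hEu : IsEulerian E) {v : Site 2} (hv : v ∈ verts E)
    (hmax : ∀ w ∈ verts E, w 0 < v 0 ∨ (w 0 = v 0 ∧ w 1 ≤ v 1)) :
    (∀ e ∈ E, v ∈ e → e = s(v - ex, v) ∨ e = s(v - ey, v)) ∧ s(v - ex, v) ∈ E ∧ s(v - ey, v) ∈ E := by
  have hshape : ∀ e ∈ E, v ∈ e → e = s(v - ex, v) ∨ e = s(v - ey, v) := by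
    intro e he hve
    have hedge := hE e he
    induction e using Sym2.ind with
    | h a b =>
      rw [Sym2.mem_iff] at hve
      have hadj : (zdGraph 2).Adj a b := by simpa using hedge
      -- the other endpoint `w` is a neighbour of `v` in `verts E`
      obtain ⟨w, hw, hvw⟩ : ∃ w, w ∈ verts E ∧ (zdGraph 2).Adj v w ∧ s(a, b) = s(v, w) := by
        rcases hve with rfl | rfl
        · exact ⟨b, mem_verts.2 ⟨_, he, Sym2.mem_mk_right _ _⟩, hadj, rfl⟩
        · exact ⟨a, mem_verts.2 ⟨_, he, Sym2.mem_mk_left _ _⟩, hadj.symm, Sym2.eq_swap⟩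
      obtain ⟨hadj', heq⟩ := hvw
      rw [heq]
      have hm := hmax w hw
      rcases stepKind_of_adj hadj' with ⟨h0, h1⟩ | ⟨h0, h1⟩ | ⟨h1, h0⟩ | ⟨h1, h0⟩
      · exfalso; omega
      · left
        have : w = v - ex := by ext i; fin_cases i <;> simp <;> omega
        rw [this, Sym2.eq_swap]
      · exfalso; omega
      · right
        have : w = v - ey := by ext i; fin_cases i <;> simp <;> omega
        rw [this, Sym2.eq_swap]
  refine ⟨hshape, ?_⟩
  -- the degree of `v` is even and positive, and at most these two edges occur
  have hsub : E.filter (fun e => v ∈ e) ⊆ {s(v - ex, v), s(v - ey, v)} := by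
    intro e he
    rw [Finset.mem_filter] at he
    rcases hshape e he.1 he.2 with rfl | rfl <;> simp
  have hne : (E.filter fun e => v ∈ e).Nonempty := by
    obtain ⟨e, he, hve⟩ := mem_verts.1 hv
    exact ⟨e, Finset.mem_filter.2 ⟨he, hve⟩⟩
  have heven : ¬ Odd #(E.filter fun e => v ∈ e) := hEu v
  have hdist : s(v - ex, v) ≠ s(v - ey, v) := by
    rw [Ne, Sym2.eq_iff]; push Not
    refine ⟨fun h => ?_, fun h => ?_⟩
    · have := congr_fun h 0; simp at this
    · have := congr_fun h 0; simp at this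
  -- so the filter is the full pair
  have hcard2 : #({s(v - ex, v), s(v - ey, v)} : Finset (Sym2 (Site 2))) = 2 := Finset.card_pair hdist
  have hfull : E.filter (fun e => v ∈ e) = {s(v - ex, v), s(v - ey, v)} := by
    refine Finset.eq_of_subset_of_card_le hsub ?_
    rw [hcard2]
    have h1 : 1 ≤ #(E.filter fun e => v ∈ e) := Finset.card_pos.2 hne
    have h2 : #(E.filter fun e => v ∈ e) ≤ 2 := by
      have := Finset.card_le_card hsub; rwa [hcard2] at this
    rcases Nat.lt_or_ge (#(E.filter fun e => v ∈ e)) 2 with h | h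
    · exfalso; apply heven
      have : #(E.filter fun e => v ∈ e) = 1 := by omega
      rw [this]; exact odd_one
    · exact h
  have hmem : ∀ e, e ∈ E.filter (fun e => v ∈ e) → e ∈ E := fun e he => (Finset.mem_filter.1 he).1
  refine ⟨hmem _ ?_, hmem _ ?_⟩ <;> rw [hfull] <;> simp

/-- **Unit squares generate the even edge sets of `ℤ²`** (Timár 2013, §2: the cycle space of `ℤ²`
is generated by the 4-cycles): every finite set of lattice edges with all degrees even is a
mod-2 sum of unit squares. Proof: induction on the lexicographically largest vertex `v`, within a
fixed bounding box; the two edges at `v` are the top and right sides of the unit square with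
upper-right corner `v`, and subtracting that square removes `v`. [cite: Timar2013, §2] -/
theorem exists_eq_xorSum_unitSq (E : Finset (Sym2 (Site 2))) (hE : ∀ e ∈ E, e ∈ (zdGraph 2).edgeSet)
    (hEu : IsEulerian E) : ∃ S : Finset (Site 2), E = xorSum unitSq S := by
  classical
  -- a bounding box for the vertices, and the rank of a vertex in it
  obtain ⟨N, hbox⟩ : ∃ N : ℕ, ∀ w ∈ verts E, ∀ i, -(N : ℤ) ≤ w i ∧ w i ≤ N := by
    refine ⟨(verts E).sup fun w => (w 0).natAbs + (w 1).natAbs, fun w hw i => ?_⟩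
    have hle : (w 0).natAbs + (w 1).natAbs ≤ (verts E).sup fun w => (w 0).natAbs + (w 1).natAbs :=
      Finset.le_sup (f := fun w : Site 2 => (w 0).natAbs + (w 1).natAbs) hw
    have h0 : ((w 0).natAbs : ℤ) = |w 0| := Int.natCast_natAbs _
    have h1 : ((w 1).natAbs : ℤ) = |w 1| := Int.natCast_natAbs _
    have hle' : ((w 0).natAbs : ℤ) + (w 1).natAbs ≤ ((verts E).sup fun w => (w 0).natAbs + (w 1).natAbs : ℕ) := by
      exact_mod_cast hle
    rw [h0, h1] at hle'
    fin_cases i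
    · change -_ ≤ w 0 ∧ w 0 ≤ _
      constructor <;> linarith [neg_abs_le (w 0), le_abs_self (w 0), abs_nonneg (w 1)]
    · change -_ ≤ w 1 ∧ w 1 ≤ _
      constructor <;> linarith [neg_abs_le (w 1), le_abs_self (w 1), abs_nonneg (w 0)]
  set rank : Site 2 → ℕ := fun w => (w 0 + N).toNat * (2 * N + 2) + (w 1 + N).toNat with hrank
  have hrank_mono : ∀ v w : Site 2, (∀ i, -(N : ℤ) ≤ v i ∧ v i ≤ N) → (∀ i, -(N : ℤ) ≤ w i ∧ w i ≤ N) →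
      (w 0 < v 0 ∨ (w 0 = v 0 ∧ w 1 ≤ v 1)) → w ≠ v → rank w < rank v := by
    intro v w hv hw h hne
    have hv0 := hv 0; have hv1 := hv 1; have hw0 := hw 0; have hw1 := hw 1
    simp only [hrank]
    have e1 : ((w 0 + N).toNat : ℤ) = w 0 + N := Int.toNat_of_nonneg (by omega)
    have e2 : ((w 1 + N).toNat : ℤ) = w 1 + N := Int.toNat_of_nonneg (by omega)
    have e3 : ((v 0 + N).toNat : ℤ) = v 0 + N := Int.toNat_of_nonneg (by omega)
    have e4 : ((v 1 + N).toNat : ℤ) = v 1 + N := Int.toNat_of_nonneg (by omega)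
    rcases h with h | ⟨h0, h1⟩
    · zify; rw [e1, e2, e3, e4]; nlinarith
    · have hne1 : w 1 ≠ v 1 := fun h' => hne (by ext i; fin_cases i <;> assumption)
      zify; rw [e1, e2, e3, e4]; nlinarith [lt_of_le_of_ne h1 hne1]
  -- induction on the maximal rank of a vertex
  suffices key : ∀ (n : ℕ) (E : Finset (Sym2 (Site 2))), (∀ e ∈ E, e ∈ (zdGraph 2).edgeSet) →
      IsEulerian E → (∀ w ∈ verts E, ∀ i, -(N : ℤ) ≤ w i ∧ w i ≤ N) → (∀ w ∈ verts E, rank w < n) →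
      ∃ S : Finset (Site 2), E = xorSum unitSq S by
    exact key (rank (fun _ => (N : ℤ)) + 1) E hE hEu hbox fun w hw =>
      Nat.lt_succ_of_le (by
        have hw' := hbox w hw
        simp only [hrank]
        have := hw' 0; have := hw' 1
        gcongr <;> omega)
  intro n
  induction n with
  | zero =>
    intro E _ _ _ hlt
    refine ⟨∅, ?_⟩
    rw [xorSum_empty]
    rw [Finset.eq_empty_iff_forall_notMem]
    intro e he
    induction e using Sym2.ind with
    | h a b => exact absurd (hlt a (mem_verts.2 ⟨_, he, Sym2.mem_mk_left _ _⟩)) (Nat.not_lt_zero _)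
  | succ n ih =>
    intro E hE hEu hbox hlt
    by_cases hempty : verts E = ∅
    · refine ⟨∅, ?_⟩
      rw [xorSum_empty, Finset.eq_empty_iff_forall_notMem]
      intro e he
      induction e using Sym2.ind with
      | h a b =>
        have : a ∈ verts E := mem_verts.2 ⟨_, he, Sym2.mem_mk_left _ _⟩
        rw [hempty] at this; simp at this
    -- the lexicographically largest vertex
    have hne : (verts E).Nonempty := Finset.nonempty_iff_ne_empty.2 hempty
    obtain ⟨v₁, hv₁, hv₁max⟩ := Finset.exists_max_image (verts E) (fun w => w 0) hne
    have hne' : ((verts E).filter fun w => w 0 = v₁ 0).Nonempty := ⟨v₁, Finset.mem_filter.2 ⟨hv₁, rfl⟩⟩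
    obtain ⟨v, hv, hvmax⟩ := Finset.exists_max_image _ (fun w => w 1) hne'
    have hvE : v ∈ verts E := (Finset.mem_filter.1 hv).1
    have hv0 : v 0 = v₁ 0 := (Finset.mem_filter.1 hv).2
    have hmax : ∀ w ∈ verts E, w 0 < v 0 ∨ (w 0 = v 0 ∧ w 1 ≤ v 1) := by
      intro w hw
      have h1 := hv₁max w hw
      rcases lt_or_eq_of_le h1 with h | h
      · exact Or.inl (by rw [hv0]; exact h)
      · exact Or.inr ⟨by rw [hv0]; exact h, hvmax w (Finset.mem_filter.2 ⟨hw, h⟩)⟩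
    obtain ⟨hshape, hex', hey'⟩ := edges_at_max_vertex hE hEu hvE hmax
    -- subtract the square with upper-right corner `v`
    set u := v - ex - ey with hu
    have hu1 : u + ex = v - ey := by rw [hu]; abel
    have hu2 : u + ey = v - ex := by rw [hu]; abel
    have hu3 : u + ex + ey = v := by rw [hu]; abel
    set E' := E ∆ unitSq u with hE'
    have hE'edge : ∀ e ∈ E', e ∈ (zdGraph 2).edgeSet := by
      intro e he
      rcases (Finset.mem_symmDiff.1 he) with ⟨h, -⟩ | ⟨h, -⟩
      · exact hE e h
      · exact unitSq_subset_edgeSet u e h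
    have hE'eu : IsEulerian E' := hEu.symmDiff (isEulerian_unitSq u)
    -- the vertices of `E'`
    have hvx : v - ex ∈ verts E := mem_verts.2 ⟨_, hex', Sym2.mem_mk_left _ _⟩
    have hvy : v - ey ∈ verts E := mem_verts.2 ⟨_, hey', Sym2.mem_mk_left _ _⟩
    have hubox : ∀ i, -(N : ℤ) ≤ u i ∧ u i ≤ N := by
      have h1 := hbox _ hvx
      have h2 := hbox _ hvy
      intro i; fin_cases i
      · have := h1 0; simp [hu] at this ⊢; exact this
      · have := h2 1; simp [hu] at this ⊢; exact this
    have hverts' : ∀ w ∈ verts E', (w ∈ verts E ∧ w ≠ v) ∨ w = u := by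
      intro w hw
      obtain ⟨e, he, hwe⟩ := mem_verts.1 hw
      rcases Finset.mem_symmDiff.1 he with ⟨heE, hesq⟩ | ⟨hesq, heE⟩
      · refine Or.inl ⟨mem_verts.2 ⟨e, heE, hwe⟩, fun hwv => hesq ?_⟩
        subst hwv
        rcases hshape e heE hwe with rfl | rfl
        · rw [← hu2, ← hu3]; exact top_mem_unitSq u
        · rw [← hu1, ← hu3]; exact right_mem_unitSq u
      · -- an edge of the square not in `E`: not one of the two edges at `v`
        rcases mem_unitSq hesq with rfl | rfl | rfl | rfl
        · rw [Sym2.mem_iff] at hwe; rcases hwe with rfl | rfl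
          · exact Or.inr rfl
          · rw [hu1]; exact Or.inl ⟨hvy, fun h => by have := congr_fun h 1; simp at this⟩
        · rw [hu3, hu1] at heE; exact absurd hey' heE
        · rw [hu3, hu2, Sym2.eq_swap] at heE; exact absurd hex' heE
        · rw [Sym2.mem_iff] at hwe; rcases hwe with rfl | rfl
          · rw [hu2]; exact Or.inl ⟨hvx, fun h => by have := congr_fun h 0; simp at this⟩
          · exact Or.inr rfl
    have hbox' : ∀ w ∈ verts E', ∀ i, -(N : ℤ) ≤ w i ∧ w i ≤ N := by
      intro w hw
      rcases hverts' w hw with ⟨h, -⟩ | rfl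
      · exact hbox w h
      · exact hubox
    have hlt' : ∀ w ∈ verts E', rank w < n := by
      intro w hw
      have hvn : rank v < n + 1 := hlt v hvE
      have hwv : rank w < rank v := by
        rcases hverts' w hw with ⟨h, hne⟩ | rfl
        · exact hrank_mono v w (hbox v hvE) (hbox w h) (hmax w h) hne
        · refine hrank_mono v u (hbox v hvE) hubox (Or.inl ?_) ?_
          · simp [hu]
          · intro h; have := congr_fun h 0; simp [hu] at this
      omega
    obtain ⟨S, hS⟩ := ih E' hE'edge hE'eu hbox' hlt'
    -- `E = E' ∆ sq(u) = xorSum (S ∆ {u})`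
    refine ⟨S ∆ {u}, ?_⟩
    rw [← xorSum_symmDiff, ← hS, show xorSum unitSq ({u} : Finset (Site 2)) = unitSq u by
      ext e; rw [mem_xorSum_iff, Finset.filter_singleton]; split_ifs with h <;> simp [h],
      hE', symmDiff_assoc, symmDiff_self, symmDiff_bot]

end Squares

end Literature.Probability.Percolation
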